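import Summits.AtomisticToContinuum.FouriersLaw.Theorems.BondHeatUncertaintySubdiffusiveBondHeatKernelGibbsF
import Mathlib.MeasureTheory.Integral.IntegralEqImproper

/-!
# Finite-window Green–Kubo bookkeeping for the pinned chain: Fubini for the windowed corrector

Support file for the shared item `BoundedResponse` (stmt-AtomisticToContinuum-10924) of route
`OddSectorIrreversibility` (sub-problem `FouriersLaw`). The route reaches `BoundedResponse` through
`WitnessGlue`, whose first step pairs the finite-horizon Kubo corrector
`u_τ = ∫₀^τ P_t J dt` (`J = ∑_i j_i` the total current, `P_t = transitionKernel N T T t` the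
equilibrium open kernels) with `J` under the Gibbs measure `π = gibbsMeasure N T` and identifies the
pairing with the windowed Green–Kubo integral `∫₀^τ c_N`, `c_N(t) = ∫ J · P_t J dπ`
("`(N-1)s = ⟨u, J⟩_π = ∫₀^∞ c_N` … CorrectorTheory B + A(4) + Fubini"). This file supplies the
fixed-`N` measure theory of that step, for `pinnedChain ω₂ lam β γ` with `ω₂ > 0`, `lam ≥ 0`,
`β, γ > 0`, `N ≥ 1`, `T > 0`:

* `one_add_sq_le_exp_mul`, `pinnedChain_abs_sum_bondCurrent_le_exp` — the total current is
  exponentially dominated, `|J| ≤ C_ϑ e^{ϑH}` for every `ϑ > 0`;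
* `pinnedChain_stronglyMeasurable_act_prod`, `pinnedChain_stronglyMeasurable_act_sum_bondCurrent` —
  `(t, z) ↦ P_{t⁺} g (z)` is jointly strongly measurable (joint measurability of the constructed
  kernels);
* `pinnedChain_sq_act_sum_bondCurrent` — `J², (P_tJ)² ∈ L¹(π)` and `∫ (P_t J)² dπ ≤ ∫ J² dπ`
  (`L²`-contraction);
* `pinnedChain_integrable_sq_act_prod`, `pinnedChain_integrable_act_mul_prod` — `(z, t) ↦ (P_tJ(z))²`
  and `(z, t) ↦ P_t J(z) · J(z)` are integrable on `π × Leb|(0, τ]` (Tonelli / domination);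
* `pinnedChain_integral_windowedCorrector_mul` — **Fubini**:
  `∫ u_τ · J dπ = ∫_{(0,τ]} c_N(t) dt` and `u_τ · J ∈ L¹(π)`;
(The square-integrability of `u_τ` is in the sequel file
`OddSectorIrreversibilityGreenKuboWindowSqIntegrable.lean`.)

Everything is stated in tree vocabulary (`pinnedChain`, `bondCurrent`, `transitionKernel`,
`gibbsMeasure`); no definitions, no named facts. Nothing here closes an item.
-/

noncomputable section

open MeasureTheory ProbabilityTheory Filter Topology Set
open scoped NNReal ENNReal

namespace Summit.AtomisticToContinuum.FouriersLaw.Theorems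

open Literature.MathematicalPhysics.KineticTheory.HeatConduction
open Literature.MathematicalPhysics.KineticTheory Literature.Probability.Process OscillatorChain
open Summit.AtomisticToContinuum.FouriersLaw.Theorems.SubdiffusiveBondHeat

variable {N : ℕ}

/-! ### Exponential domination of the total current -/

/-- `(1 + H)² ≤ (2 e^ϑ / ϑ²) · e^{ϑ H}` for `ϑ > 0`, `H ≥ 0` (`x²/2 ≤ eˣ` at `x = ϑ(1 + H)`).
[folklore] -/
theorem one_add_sq_le_exp_mul {ϑ H : ℝ} (hϑ : 0 < ϑ) (hH : 0 ≤ H) :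
    (1 + H) ^ 2 ≤ 2 * Real.exp ϑ / ϑ ^ 2 * Real.exp (ϑ * H) := by
  have hx : 0 ≤ ϑ * (1 + H) := by positivity
  have h1 : (ϑ * (1 + H)) ^ 2 / 2 ≤ Real.exp (ϑ * (1 + H)) := by
    simpa [Nat.factorial] using Real.pow_div_factorial_le_exp (ϑ * (1 + H)) hx 2
  have h2 : Real.exp (ϑ * (1 + H)) = Real.exp ϑ * Real.exp (ϑ * H) := by
    rw [← Real.exp_add]; ring_nf
  rw [h2, mul_pow] at h1
  have hϑ2 : 0 < ϑ ^ 2 := by positivity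
  rw [div_mul_eq_mul_div, le_div_iff₀ hϑ2]
  nlinarith [h1, Real.exp_pos ϑ, Real.exp_pos (ϑ * H)]

/-- **The total current is exponentially dominated**: for `ω₂, lam, β ≥ 0` and every `ϑ > 0`,
`|∑_i j_i(z)| ≤ N² (3+β)/2 · (2e^ϑ/ϑ²) · e^{ϑ H(z)}` (from `|j_i| ≤ N (3+β)/2 (1+H)²`,
`pinnedChain_abs_bondCurrent_le`, and `H ≥ 0`). [folklore] -/
theorem pinnedChain_abs_sum_bondCurrent_le_exp {ω₂ lam β : ℝ} (hω : 0 ≤ ω₂) (hl : 0 ≤ lam)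
    (hβ : 0 ≤ β) (γ : ℝ) (N : ℕ) {ϑ : ℝ} (hϑ : 0 < ϑ) (z : PhaseSpace N) :
    |∑ i : Fin N, (pinnedChain ω₂ lam β γ).bondCurrent N i z| ≤
      (N * (N * ((3 + β) / 2)) * (2 * Real.exp ϑ / ϑ ^ 2)) *
        Real.exp (ϑ * (pinnedChain ω₂ lam β γ).hamiltonian N z) := by
  have hH0 := pinnedChain_hamiltonian_nonneg hω hl hβ γ N z
  have hsq := one_add_sq_le_exp_mul hϑ hH0
  calc |∑ i : Fin N, (pinnedChain ω₂ lam β γ).bondCurrent N i z|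
      ≤ ∑ i : Fin N, |(pinnedChain ω₂ lam β γ).bondCurrent N i z| := Finset.abs_sum_le_sum_abs _ _
    _ ≤ ∑ _i : Fin N, (N : ℝ) * ((3 + β) / 2 *
          (1 + (pinnedChain ω₂ lam β γ).hamiltonian N z) ^ 2) :=
        Finset.sum_le_sum fun i _ => pinnedChain_abs_bondCurrent_le hω hl hβ γ N i z
    _ = N * (N * ((3 + β) / 2 * (1 + (pinnedChain ω₂ lam β γ).hamiltonian N z) ^ 2)) := by
        simp [Finset.sum_const, Finset.card_univ, Fintype.card_fin]
    _ ≤ N * (N * ((3 + β) / 2 * (2 * Real.exp ϑ / ϑ ^ 2 *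
          Real.exp (ϑ * (pinnedChain ω₂ lam β γ).hamiltonian N z)))) := by
        have h3 : (0 : ℝ) ≤ (3 + β) / 2 := by positivity
        gcongr
    _ = _ := by ring

/-! ### Joint measurability of `(t, z) ↦ P_{t⁺} g (z)` -/

/-- For a strongly measurable `g`, `(t, z) ↦ ∫ g dP_{t⁺}(z, ·)` is jointly strongly measurable on
`ℝ × PhaseSpace N` (the constructed kernels are jointly measurable in `(t, z)`,
`pinnedChain_measurable_transitionKernel`, so they form ONE kernel on `ℝ≥0 × PhaseSpace N`).
[folklore] -/
theorem pinnedChain_stronglyMeasurable_act_prod {ω₂ lam β γ : ℝ} (hω : 0 < ω₂) (hl : 0 ≤ lam)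
    (hβ : 0 ≤ β) (hγ : 0 ≤ γ) (N : ℕ) (T_L T_R : ℝ) {g : PhaseSpace N → ℝ}
    (hg : StronglyMeasurable g) :
    StronglyMeasurable fun p : ℝ × PhaseSpace N =>
      ∫ y, g y ∂((pinnedChain ω₂ lam β γ).transitionKernel N T_L T_R p.1.toNNReal p.2) := by
  have hmeas := pinnedChain_measurable_transitionKernel hω hl hβ hγ N T_L T_R
  have h2 : Measurable fun p : ℝ × PhaseSpace N => (p.1.toNNReal, p.2) :=
    (measurable_real_toNNReal.comp measurable_fst).prodMk measurable_snd
  let κ₂ : Kernel (ℝ × PhaseSpace N) (PhaseSpace N) := Kernel.mk _ (hmeas.comp h2)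
  have h1 : StronglyMeasurable fun p : ℝ × PhaseSpace N => ∫ y, g y ∂(κ₂ p) :=
    hg.integral_kernel (κ := κ₂)
  exact h1


/-! ### Fubini for the windowed corrector at equal bath temperatures -/

section Window

variable {ω₂ lam β γ : ℝ} (hω : 0 < ω₂) (hl : 0 ≤ lam) (hβ : 0 < β) (hγ : 0 < γ) {N : ℕ} (hN : 0 <
      N)
  {T : ℝ} (hT : 0 < T)


omit hN hT in
/-- The total current `J = ∑_i j_i` is continuous. [folklore] -/
theorem pinnedChain_continuous_sum_bondCurrent :
    Continuous fun z : PhaseSpace N => (∑ i : Fin N, (pinnedChain ω₂ lam β γ).bondCurrent N i z) :=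
  continuous_finsetSum _ fun i _ => pinnedChain_continuous_bondCurrent ω₂ lam β γ N i

include hω hl hβ hγ hN hT

/-- **`L²(π)`-contraction for the total current**: `J² ∈ L¹(π)`, `(P_{t⁺} J)² ∈ L¹(π)` and
`∫ (P_{t⁺} J)² dπ ≤ ∫ J² dπ` (`pinnedChain_integral_sq_act_le` with the exponential domination of
`J` at `ϑ = 1/(4T)`). [folklore] -/
theorem pinnedChain_sq_act_sum_bondCurrent (t : ℝ) :
    Integrable (fun y => (∑ i : Fin N, (pinnedChain ω₂ lam β γ).bondCurrent N i y) ^ 2)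
          ((pinnedChain ω₂ lam β γ).gibbsMeasure N T) ∧ Integrable (fun z => (∫ y, (∑ i : Fin N,
          (pinnedChain ω₂ lam β γ).bondCurrent N i y) ∂((pinnedChain ω₂ lam β γ).transitionKernel N
          T T (Real.toNNReal t) z)) ^ 2) ((pinnedChain ω₂ lam β γ).gibbsMeasure N T) ∧
      ∫ z, (∫ y, (∑ i : Fin N, (pinnedChain ω₂ lam β γ).bondCurrent N i y) ∂((pinnedChain ω₂ lam β
            γ).transitionKernel N T T (Real.toNNReal t) z)) ^ 2 ∂((pinnedChain ω₂ lam β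
            γ).gibbsMeasure N T) ≤ ∫ z, (∑ i : Fin N, (pinnedChain ω₂ lam β γ).bondCurrent N i z) ^
            2 ∂((pinnedChain ω₂ lam β γ).gibbsMeasure N T) := by
  have hϑ0 : 0 < 1 / (4 * T) := by positivity
  have h2ϑ : 2 * (1 / (4 * T)) < 1 / T := by
    have h2 : 2 * (1 / (4 * T)) = 1 / (2 * T) := by field_simp; ring
    rw [h2]
    exact one_div_lt_one_div_of_lt hT (by linarith)
  exact pinnedChain_integral_sq_act_le hω hl hβ hγ hN hT hϑ0 h2ϑ
    (pinnedChain_continuous_sum_bondCurrent)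
    (pinnedChain_abs_sum_bondCurrent_le_exp hω.le hl hβ.le γ N hϑ0) t.toNNReal

omit hN hT in
/-- `(z, t) ↦ P_{t⁺}J(z)` is jointly strongly measurable. [folklore] -/
theorem pinnedChain_stronglyMeasurable_act_sum_bondCurrent :
    StronglyMeasurable fun p : PhaseSpace N × ℝ => (∫ y, (∑ i : Fin N, (pinnedChain ω₂ lam β
          γ).bondCurrent N i y) ∂((pinnedChain ω₂ lam β γ).transitionKernel N T T (Real.toNNReal
          p.2) p.1)) := by
  have h1 := pinnedChain_stronglyMeasurable_act_prod hω hl hβ.le hγ.le N T T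
    (pinnedChain_continuous_sum_bondCurrent (ω₂ := ω₂) (lam := lam) (β := β) (γ := γ)
      (N := N)).stronglyMeasurable
  have h2 := h1.comp_measurable (measurable_swap (α := PhaseSpace N) (β := ℝ))
  exact h2

/-- **Tonelli for `(P_tJ)²`**: `(z, t) ↦ (P_{t⁺}J(z))²` is integrable on `π × Leb|_{(0,τ]}` (every
`t`-slice is in `L¹(π)` with integral `≤ ∫ J² dπ`, and the slice integrals are measurable in `t`).
[folklore] -/
theorem pinnedChain_integrable_sq_act_prod (τ : ℝ) :
    Integrable (fun p : PhaseSpace N × ℝ => (∫ y, (∑ i : Fin N, (pinnedChain ω₂ lam β γ).bondCurrent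
          N i y) ∂((pinnedChain ω₂ lam β γ).transitionKernel N T T (Real.toNNReal p.2) p.1)) ^ 2)
          ((((pinnedChain ω₂ lam β γ).gibbsMeasure N T)).prod (Measure.restrict (volume : Measure ℝ)
          (Set.Ioc (0 : ℝ) τ))) := by
  haveI : IsProbabilityMeasure ((pinnedChain ω₂ lam β γ).gibbsMeasure N T) :=
        pinnedChain_isProbabilityMeasure_gibbsMeasure hω hl hβ.le γ N hT
  haveI : IsFiniteMeasure (Measure.restrict (volume : Measure ℝ) (Set.Ioc (0 : ℝ) τ)) :=
        isFiniteMeasure_restrict.2 measure_Ioc_lt_top.ne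
  have hm2 : StronglyMeasurable fun p : PhaseSpace N × ℝ => (∫ y, (∑ i : Fin N, (pinnedChain ω₂ lam
        β γ).bondCurrent N i y) ∂((pinnedChain ω₂ lam β γ).transitionKernel N T T (Real.toNNReal
        p.2) p.1)) ^ 2 :=
    (pinnedChain_stronglyMeasurable_act_sum_bondCurrent hω hl hβ hγ).pow 2
  refine (integrable_prod_iff' hm2.aestronglyMeasurable).2 ⟨?_, ?_⟩
  · exact Eventually.of_forall fun t => (pinnedChain_sq_act_sum_bondCurrent hω hl hβ hγ hN hT t).2.1
  · have hm : StronglyMeasurable fun t : ℝ => ∫ z, ‖(∫ y, (∑ i : Fin N, (pinnedChain ω₂ lam β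
        γ).bondCurrent N i y) ∂((pinnedChain ω₂ lam β γ).transitionKernel N T T (Real.toNNReal t)
        z)) ^ 2‖ ∂((pinnedChain ω₂ lam β γ).gibbsMeasure N T) := hm2.norm.integral_prod_left'
    refine Integrable.mono' (integrable_const (∫ z, (∑ i : Fin N, (pinnedChain ω₂ lam β
          γ).bondCurrent N i z) ^ 2 ∂((pinnedChain ω₂ lam β γ).gibbsMeasure N T)))
          hm.aestronglyMeasurable
      (Eventually.of_forall fun t => ?_)
    have hle := (pinnedChain_sq_act_sum_bondCurrent hω hl hβ hγ hN hT t).2.2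
    have heq : ∫ z, ‖(∫ y, (∑ i : Fin N, (pinnedChain ω₂ lam β γ).bondCurrent N i y) ∂((pinnedChain
          ω₂ lam β γ).transitionKernel N T T (Real.toNNReal t) z)) ^ 2‖ ∂((pinnedChain ω₂ lam β
          γ).gibbsMeasure N T) = ∫ z, (∫ y, (∑ i : Fin N, (pinnedChain ω₂ lam β γ).bondCurrent N i
          y) ∂((pinnedChain ω₂ lam β γ).transitionKernel N T T (Real.toNNReal t) z)) ^ 2
          ∂((pinnedChain ω₂ lam β γ).gibbsMeasure N T) :=
      integral_congr_ae (Eventually.of_forall fun z => Real.norm_of_nonneg (sq_nonneg _))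
    rw [heq, Real.norm_of_nonneg (integral_nonneg fun z => sq_nonneg _)]
    exact hle

/-- **Product integrability**: `(z, t) ↦ P_{t⁺}J(z) · J(z)` is integrable on `π × Leb|_{(0,τ]}`
(domination by `((P_tJ)² + J²)/2`). [folklore] -/
theorem pinnedChain_integrable_act_mul_prod (τ : ℝ) :
    Integrable (fun p : PhaseSpace N × ℝ => (∫ y, (∑ i : Fin N, (pinnedChain ω₂ lam β γ).bondCurrent
          N i y) ∂((pinnedChain ω₂ lam β γ).transitionKernel N T T (Real.toNNReal p.2) p.1)) * (∑ i
          : Fin N, (pinnedChain ω₂ lam β γ).bondCurrent N i p.1)) ((((pinnedChain ω₂ lam β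
          γ).gibbsMeasure N T)).prod (Measure.restrict (volume : Measure ℝ) (Set.Ioc (0 : ℝ) τ))) :=
          by
  haveI : IsProbabilityMeasure ((pinnedChain ω₂ lam β γ).gibbsMeasure N T) :=
        pinnedChain_isProbabilityMeasure_gibbsMeasure hω hl hβ.le γ N hT
  haveI : IsFiniteMeasure (Measure.restrict (volume : Measure ℝ) (Set.Ioc (0 : ℝ) τ)) :=
        isFiniteMeasure_restrict.2 measure_Ioc_lt_top.ne
  have hJc : Continuous fun z : PhaseSpace N => (∑ i : Fin N, (pinnedChain ω₂ lam β γ).bondCurrent N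
        i z) := pinnedChain_continuous_sum_bondCurrent
  have hJ2 : Integrable (fun z => (∑ i : Fin N, (pinnedChain ω₂ lam β γ).bondCurrent N i z) ^ 2)
        ((pinnedChain ω₂ lam β γ).gibbsMeasure N T) :=
    (pinnedChain_sq_act_sum_bondCurrent hω hl hβ hγ hN hT 0).1
  have hPJm : StronglyMeasurable fun p : PhaseSpace N × ℝ => (∫ y, (∑ i : Fin N, (pinnedChain ω₂ lam
        β γ).bondCurrent N i y) ∂((pinnedChain ω₂ lam β γ).transitionKernel N T T (Real.toNNReal
        p.2) p.1)) :=
    pinnedChain_stronglyMeasurable_act_sum_bondCurrent hω hl hβ hγ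
  have hJm : StronglyMeasurable fun p : PhaseSpace N × ℝ => (∑ i : Fin N, (pinnedChain ω₂ lam β
        γ).bondCurrent N i p.1) :=
    hJc.stronglyMeasurable.comp_measurable measurable_fst
  have hG1 : Integrable (fun p : PhaseSpace N × ℝ => (∑ i : Fin N, (pinnedChain ω₂ lam β
        γ).bondCurrent N i p.1) ^ 2) ((((pinnedChain ω₂ lam β γ).gibbsMeasure N T)).prod
        (Measure.restrict (volume : Measure ℝ) (Set.Ioc (0 : ℝ) τ))) := by
    have h := hJ2.mul_prod (integrable_const (1 : ℝ) : Integrable (fun _ : ℝ => (1 : ℝ))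
          (Measure.restrict (volume : Measure ℝ) (Set.Ioc (0 : ℝ) τ)))
    simpa using h
  have hG2 := pinnedChain_integrable_sq_act_prod hω hl hβ hγ hN hT τ
  have hG : Integrable (fun p : PhaseSpace N × ℝ => ((∫ y, (∑ i : Fin N, (pinnedChain ω₂ lam β
        γ).bondCurrent N i y) ∂((pinnedChain ω₂ lam β γ).transitionKernel N T T (Real.toNNReal p.2)
        p.1)) ^ 2 + (∑ i : Fin N, (pinnedChain ω₂ lam β γ).bondCurrent N i p.1) ^ 2) / 2)
      ((((pinnedChain ω₂ lam β γ).gibbsMeasure N T)).prod (Measure.restrict (volume : Measure ℝ)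
            (Set.Ioc (0 : ℝ) τ))) := (hG2.add hG1).div_const 2
  refine hG.mono' (hPJm.mul hJm).aestronglyMeasurable (Eventually.of_forall fun p => ?_)
  rw [Real.norm_eq_abs, abs_mul]
  nlinarith [sq_nonneg (|(∫ y, (∑ i : Fin N, (pinnedChain ω₂ lam β γ).bondCurrent N i y)
        ∂((pinnedChain ω₂ lam β γ).transitionKernel N T T (Real.toNNReal p.2) p.1))| - |(∑ i : Fin
        N, (pinnedChain ω₂ lam β γ).bondCurrent N i p.1)|), sq_abs ((∫ y, (∑ i : Fin N, (pinnedChain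
        ω₂ lam β γ).bondCurrent N i y) ∂((pinnedChain ω₂ lam β γ).transitionKernel N T T
        (Real.toNNReal p.2) p.1))), sq_abs ((∑ i : Fin N, (pinnedChain ω₂ lam β γ).bondCurrent N i
        p.1))]

/-- **Fubini for the windowed corrector.** With `u_τ(z) = ∫_{(0,τ]} P_tJ(z) dt` the finite-horizon
Kubo corrector of the total current and `c_N(t) = ∫ J · P_tJ dπ` the equilibrium current
autocorrelation: `u_τ · J ∈ L¹(π)` and `∫ u_τ J dπ = ∫_{(0,τ]} c_N(t) dt`. [folklore] -/
theorem pinnedChain_integral_windowedCorrector_mul (τ : ℝ) :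
    Integrable (fun z => (∫ t in Ioc 0 τ, (∫ y, (∑ i : Fin N, (pinnedChain ω₂ lam β γ).bondCurrent N
          i y) ∂((pinnedChain ω₂ lam β γ).transitionKernel N T T (Real.toNNReal t) z))) * (∑ i : Fin
          N, (pinnedChain ω₂ lam β γ).bondCurrent N i z)) ((pinnedChain ω₂ lam β γ).gibbsMeasure N
          T) ∧
      ∫ z, (∫ t in Ioc 0 τ, (∫ y, (∑ i : Fin N, (pinnedChain ω₂ lam β γ).bondCurrent N i y)
            ∂((pinnedChain ω₂ lam β γ).transitionKernel N T T (Real.toNNReal t) z))) * (∑ i : Fin N,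
            (pinnedChain ω₂ lam β γ).bondCurrent N i z) ∂((pinnedChain ω₂ lam β γ).gibbsMeasure N T)
            = ∫ t in Ioc 0 τ, (∫ z, (∑ i : Fin N, (pinnedChain ω₂ lam β γ).bondCurrent N i z) * (∫
            y, (∑ i : Fin N, (pinnedChain ω₂ lam β γ).bondCurrent N i y) ∂((pinnedChain ω₂ lam β
            γ).transitionKernel N T T (Real.toNNReal t) z)) ∂((pinnedChain ω₂ lam β γ).gibbsMeasure
            N T)) := by
  haveI : IsProbabilityMeasure ((pinnedChain ω₂ lam β γ).gibbsMeasure N T) :=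
        pinnedChain_isProbabilityMeasure_gibbsMeasure hω hl hβ.le γ N hT
  haveI : IsFiniteMeasure (Measure.restrict (volume : Measure ℝ) (Set.Ioc (0 : ℝ) τ)) :=
        isFiniteMeasure_restrict.2 measure_Ioc_lt_top.ne
  have hF := pinnedChain_integrable_act_mul_prod hω hl hβ hγ hN hT τ
  have h1 : ∀ z : PhaseSpace N, (∫ t in Ioc 0 τ, (∫ y, (∑ i : Fin N, (pinnedChain ω₂ lam β
        γ).bondCurrent N i y) ∂((pinnedChain ω₂ lam β γ).transitionKernel N T T (Real.toNNReal t)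
        z))) * (∑ i : Fin N, (pinnedChain ω₂ lam β γ).bondCurrent N i z) = ∫ t in Ioc 0 τ, (∫ y, (∑
        i : Fin N, (pinnedChain ω₂ lam β γ).bondCurrent N i y) ∂((pinnedChain ω₂ lam β
        γ).transitionKernel N T T (Real.toNNReal t) z)) * (∑ i : Fin N, (pinnedChain ω₂ lam β
        γ).bondCurrent N i z) :=
    fun z => (integral_mul_const ((∑ i : Fin N, (pinnedChain ω₂ lam β γ).bondCurrent N i z)) fun t
          => (∫ y, (∑ i : Fin N, (pinnedChain ω₂ lam β γ).bondCurrent N i y) ∂((pinnedChain ω₂ lam β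
          γ).transitionKernel N T T (Real.toNNReal t) z))).symm
  refine ⟨?_, ?_⟩
  · exact hF.integral_prod_left.congr (Eventually.of_forall fun z => (h1 z).symm)
  · calc ∫ z, (∫ t in Ioc 0 τ, (∫ y, (∑ i : Fin N, (pinnedChain ω₂ lam β γ).bondCurrent N i y)
        ∂((pinnedChain ω₂ lam β γ).transitionKernel N T T (Real.toNNReal t) z))) * (∑ i : Fin N,
        (pinnedChain ω₂ lam β γ).bondCurrent N i z) ∂((pinnedChain ω₂ lam β γ).gibbsMeasure N T)
          = ∫ z, (∫ t in Ioc 0 τ, (∫ y, (∑ i : Fin N, (pinnedChain ω₂ lam β γ).bondCurrent N i y)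
                ∂((pinnedChain ω₂ lam β γ).transitionKernel N T T (Real.toNNReal t) z)) * (∑ i : Fin
                N, (pinnedChain ω₂ lam β γ).bondCurrent N i z)) ∂((pinnedChain ω₂ lam β
                γ).gibbsMeasure N T) :=
          integral_congr_ae (Eventually.of_forall h1)
      _ = ∫ t in Ioc 0 τ, (∫ z, (∫ y, (∑ i : Fin N, (pinnedChain ω₂ lam β γ).bondCurrent N i y)
            ∂((pinnedChain ω₂ lam β γ).transitionKernel N T T (Real.toNNReal t) z)) * (∑ i : Fin N,
            (pinnedChain ω₂ lam β γ).bondCurrent N i z) ∂((pinnedChain ω₂ lam β γ).gibbsMeasure N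
            T)) :=
          integral_integral_swap (f := fun (z : PhaseSpace N) (t : ℝ) => (∫ y, (∑ i : Fin N,
                (pinnedChain ω₂ lam β γ).bondCurrent N i y) ∂((pinnedChain ω₂ lam β
                γ).transitionKernel N T T (Real.toNNReal t) z)) * (∑ i : Fin N, (pinnedChain ω₂ lam
                β γ).bondCurrent N i z)) hF
      _ = ∫ t in Ioc 0 τ, (∫ z, (∑ i : Fin N, (pinnedChain ω₂ lam β γ).bondCurrent N i z) * (∫ y, (∑
            i : Fin N, (pinnedChain ω₂ lam β γ).bondCurrent N i y) ∂((pinnedChain ω₂ lam β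
            γ).transitionKernel N T T (Real.toNNReal t) z)) ∂((pinnedChain ω₂ lam β γ).gibbsMeasure
            N T)) := by
          refine integral_congr_ae (Eventually.of_forall fun t => ?_)
          exact integral_congr_ae (Eventually.of_forall fun z => mul_comm _ _)

end Window

end Summit.AtomisticToContinuum.FouriersLaw.Theorems

end
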